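import Literature.AlgebraicGeometry.PlaneCurves.HessePencilTriangles
import HarnessLib

/-!
# The Hesse pencil in characteristic `3` (Artebani–Dolgachev, Remarks 2.1 and 5.5)

Topic `Literature/AlgebraicGeometry/PlaneCurves`, namespace `Literature.AlgebraicGeometry.PlaneCurves`.
Lane `lit-hodgefound`, seat `lit-hodgefound-p37`, row g21-#1; a one-file sequel of
`HessePencilTriangles` (g17-#9: the nine base points `hesse_basePoint_cases` over any field
containing `ω` with `ω² + ω + 1 = 0`, and Remark 2.1's `H_μ = (X + Y + Z)³` when `3 = 0`).
Everything here is PROVED (polynomial identities and case analyses); no definition, no named fact.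

Source followed — M. Artebani, I. Dolgachev, *The Hesse pencil of plane cubic curves*,
L'Enseignement Math. (2) 55 (2009) 235–273 [arXiv:math/0611590, held `paper:arxiv-math_0611590`
p0005 L58–L65 (Remark 2.1), p0008 L12–L14 (`g₁`), p0011 L46–L57 (Remark 5.5)], VERBATIM:

> (Remark 2.1) The Hesse pencil makes sense over a field of any characteristic […] The Hesse
> pencil (hessep) [`λx³ + y³ + z³ + λxyz`-pencil `E_λ : x³ + y³ + z³ + λxyz = 0`] in characteristic
> 3 has two singular members: `(x + y + z)³ = 0` and `xyz = 0`. It has three base points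
> `(1, −1, 0), (0, 1, −1), (1, 0, −1)`, each of multiplicity 3, which are the inflection points of
> all nonsingular members of the pencil.
> (§4) `g₁(x, y, z) = (y, z, x)`.
> (Remark 5.5) In characteristic 3 […] The polynomials
> `(X, Y, Z, W) = (x²y + y²z + z²x, xy² + yz² + zx², x³ + y³ + z³, xyz)` are invariant with
> respect to `g₁` and map `ℙ²` onto a cubic surface in `ℙ³` given by the equation (see [Ran], (3.1))
> `X³ + Y³ + Z²W = XYZ`. Among the singular points of the cubic surface, `(0, 0, 0, 1)` is a rational
> double point of type `E₆⁽¹⁾` in Artin's notation. The image of the member `E_λ` of the Hesse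
> pencil is the plane section `Z + λW = 0`. Substituting in equation (cubic), we find that the
> image of this pencil of plane sections under the projection from the singular point is the Hesse
> pencil. The parameter `λ` of the original pencil and the new parameter `λ′` are related by
> `λ = λ′³`.

## Dictionary

* The member `E_t = x³ + y³ + z³ + t·xyz` is the local notation `𝐄[t]` (in the seat's other files the
  members are written `H_μ = E_{−3μ}`; that parametrisation is useless when `3 = 0`, where every
  `H_μ` is `(X + Y + Z)³`, so here the printed `E_λ` itself is used); "characteristic `3`" is the
  hypothesis `(3 : K) = 0`.
* The four polynomials of Remark 5.5 are the local notations `𝓧 = X²Y + Y²Z + Z²X`,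
  `𝓨 = XY² + YZ² + ZX²`, `𝓩 = X³ + Y³ + Z³`, `𝓦 = XYZ` in `R[X, Y, Z]`, the cubic surface is
  `𝐒 = U₀³ + U₁³ + U₂²U₃ − U₀U₁U₂` in `R[U₀, U₁, U₂, U₃]`; "`f` is invariant with respect to `g₁`"
  is `rename (1 2 0) f = f` (the substitution `(x, y, z) ↦ (y, z, x)`); "maps `ℙ²` [in]to the
  surface" is `𝐒(𝓧, 𝓨, 𝓩, 𝓦) = 0` in `R[X, Y, Z]` (`bind₁`).
* A flex of `E_t` at a smooth point `q` (`∇E_t(q) ≠ 0`): every line through `q` inside the tangent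
  (`⟨∇E_t(q), v⟩ = 0`) meets `E_t` at `q` with multiplicity `≥ 3`, i.e. `T³ ∣ E_t(q + Tv)`
  (`HyperbolicPolynomials.linePoly`, the shape of `HessePencilTriangles.hesse_nine_basePoints_flex`).

## What is here

* §1 **Remark 2.1** (`K` a field with `3 = 0`): `hesseE_of_three_eq_zero`
  (`E_t = (X + Y + Z)³ + t·XYZ` — "the pencil is `xyz + t(x + y + z)³`"), the singular member
  `hesseE_zero_of_three_eq_zero` (`E_0 = (X + Y + Z)³`; the other one, `xyz`, is `E_∞`); the gradient
  `hesseE_eval_pderiv_of_three_eq_zero` (`∇E_t = t·(yz, xz, xy)`); **`hesseE_singular_iff_of_three_eq_zero`**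
  (`E_t` has a singular point iff `t = 0` — "nonsingular members" are `t ≠ 0`);
  **`hesse_basePoint_cases_of_three_eq_zero`** (a non-zero common zero of `XYZ` and `X³ + Y³ + Z³`
  is `c·(0, 1, −1)`, `c·(1, 0, −1)` or `c·(1, −1, 0)` — "three base points"), `hesse_three_basePoints`
  (they lie on every member), `cube_add_cube_of_three_eq_zero` (`u³ + v³ = (u + v)³`: on each side of
  `xyz = 0` the base point is a triple root — "each of multiplicity `3`"), and
  **`hesse_three_basePoints_flex_of_three_eq_zero`** ("which are the inflection points of all
  nonsingular members": for `t ≠ 0` each of the three is a smooth point of `E_t` at which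
  `T³ ∣ E_t(q + Tv)` for every tangent direction `v`).
* §2 **Remark 5.5** (`R` any commutative ring unless `3 = 0` is assumed): `rename_g₁_XYZW`
  (`𝓧, 𝓨, 𝓩, 𝓦` are `g₁`-invariant); **`cubicSurface_identity`** (the integral identity
  `𝓧³ + 𝓨³ + 𝓩²𝓦 − 𝓧𝓨𝓩 = 3·𝓦·(𝓩𝓦 + 2(X³Y³ + Y³Z³ + Z³X³) + 3𝓦²)`, whence
  **`cubicSurface_of_three_eq_zero`**: `𝓧³ + 𝓨³ + 𝓩²𝓦 = 𝓧𝓨𝓩` when `3 = 0`, and `bind₁_cubicSurface…`: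
  `𝐒(𝓧, 𝓨, 𝓩, 𝓦) = 0`); `cubicSurface_singular_vertex` (`𝐒` and its four partials vanish at
  `(0, 0, 0, 1)`, over any ring); `hesseE_eq_section` (`E_t = 𝓩 + t𝓦`: "the image of `E_λ` is the plane
  section `Z + λW = 0`"); **`bind₁_hesseE_projection_of_three_eq_zero`** ("`λ = λ′³`": for `3 = 0`,
  `E_s(s𝓧, s𝓨, −𝓩) = −𝓩² · E_{s³}` in `K[X, Y, Z]` — the projection `(X : Y : Z)` from the singular
  point carries the section of `E_{s³}` into the cubic `E_s ∘ diag(s, s, −1)`, projectively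
  equivalent to `E_s`; the integral form `bind₁_hesseE_projection` holds over any ring with the
  error term `3s³·𝓦·(…)`), and its pointwise form `eval_hesseE_projection_of_three_eq_zero`.

NOT here: "onto" the surface and the type `E₆⁽¹⁾` of the double point; Remark 5.5's first sentence
(`g₁` acts as translation by a `3`-torsion point with zero `(1, −1, 0)` — a group-law statement in
characteristic `3`, where the seat's Weierstrass transport `N_μ` of `HessePencilGroupLaw` is not
available); intersection multiplicities beyond the triple-root identity; [Ran], [Smart].

Rider (gen 21, §1b): `hesse_member_eval_grad_of_three_eq_zero`, **`hesse_pencil_singular_iff_of_three_eq_zero`**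
(for `3 = 0` the member `s(x³+y³+z³) + t·xyz` has a singular point iff `st = 0`: "two singular members").

## References
* [ArtebaniDolgachev2009] M. Artebani, I. Dolgachev, *The Hesse pencil of plane cubic curves*,
  Enseign. Math. (2) 55 (2009) 235–273, §2 Remark 2.1, §4 (the generator `g₁`), §5 Remark 5.5
  (after K. Ranestad, [Ran] (3.1)).
-/

set_option autoImplicit false

open MvPolynomial Matrix
open Literature.AlgebraicGeometry.HyperbolicPolynomials

namespace Literature.AlgebraicGeometry.PlaneCurves

universe u

/-- The member `E_t = X³ + Y³ + Z³ + t·XYZ` of the Hesse pencil (local notation, no definition). -/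
local notation3 "𝐄[" t "]" =>
  (X 0 ^ 3 + X 1 ^ 3 + X 2 ^ 3 + C t * (X 0 * X 1 * X 2) : MvPolynomial (Fin 3) _)

/-- Remark 5.5's `X = x²y + y²z + z²x` (local notation). -/
local notation3 "𝓧" => (X 0 ^ 2 * X 1 + X 1 ^ 2 * X 2 + X 2 ^ 2 * X 0 : MvPolynomial (Fin 3) _)
/-- Remark 5.5's `Y = xy² + yz² + zx²` (local notation). -/
local notation3 "𝓨" => (X 0 * X 1 ^ 2 + X 1 * X 2 ^ 2 + X 2 * X 0 ^ 2 : MvPolynomial (Fin 3) _)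
/-- Remark 5.5's `Z = x³ + y³ + z³` (local notation). -/
local notation3 "𝓩" => (X 0 ^ 3 + X 1 ^ 3 + X 2 ^ 3 : MvPolynomial (Fin 3) _)
/-- Remark 5.5's `W = xyz` (local notation). -/
local notation3 "𝓦" => (X 0 * X 1 * X 2 : MvPolynomial (Fin 3) _)
/-- The cubic surface `X³ + Y³ + Z²W − XYZ` of Remark 5.5 in `R[U₀, U₁, U₂, U₃]` (local notation). -/
local notation3 "𝐒" =>
  (X 0 ^ 3 + X 1 ^ 3 + X 2 ^ 2 * X 3 - X 0 * X 1 * X 2 : MvPolynomial (Fin 4) _)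

section RemarkTwoOne

variable {K : Type u} [Field K]

/-! ## §1 Remark 2.1: the pencil in characteristic `3` -/

/-- `E_t(p) = p₀³ + p₁³ + p₂³ + t·p₀p₁p₂`. [cite: ArtebaniDolgachev2009, §2 (the Hesse pencil
`λx³ + y³ + z³ + λxyz`… `E_λ`)] -/
theorem hesseE_eval (t : K) (p : Fin 3 → K) :
    eval p 𝐄[t] = p 0 ^ 3 + p 1 ^ 3 + p 2 ^ 3 + t * (p 0 * p 1 * p 2) := by
  simp

/-- The partial derivatives of `E_t` over any field: `∂E_t/∂x = 3x² + t·yz`, …. [folklore] -/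
private theorem pderiv_hesseE (t : K) :
    (pderiv 0 𝐄[t] = C 3 * X 0 ^ 2 + C t * (X 1 * X 2)) ∧
    (pderiv 1 𝐄[t] = C 3 * X 1 ^ 2 + C t * (X 0 * X 2)) ∧
    (pderiv 2 𝐄[t] = C 3 * X 2 ^ 2 + C t * (X 0 * X 1)) := by
  refine ⟨?_, ?_, ?_⟩ <;> simp [pderiv_X, map_ofNat, mul_comm]

/-- **The gradient of `E_t`**: `∇E_t(p) = (3p₀² + t p₁p₂, 3p₁² + t p₀p₂, 3p₂² + t p₀p₁)` over any
field. [cite: ArtebaniDolgachev2009, §5 (the tangent line `(x₀² + ty₀z₀)x + … = 0` of `E_{3t}`)] -/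
theorem hesseE_eval_pderiv (t : K) (p : Fin 3 → K) :
    (fun i => eval p (pderiv i 𝐄[t])) =
      ![3 * p 0 ^ 2 + t * (p 1 * p 2), 3 * p 1 ^ 2 + t * (p 0 * p 2),
        3 * p 2 ^ 2 + t * (p 0 * p 1)] := by
  obtain ⟨d0, d1, d2⟩ := pderiv_hesseE t
  funext i
  fin_cases i
  · show eval p (pderiv 0 𝐄[t]) = 3 * p 0 ^ 2 + t * (p 1 * p 2)
    rw [d0]; simp [map_ofNat]
  · show eval p (pderiv 1 𝐄[t]) = 3 * p 1 ^ 2 + t * (p 0 * p 2)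
    rw [d1]; simp [map_ofNat]
  · show eval p (pderiv 2 𝐄[t]) = 3 * p 2 ^ 2 + t * (p 0 * p 1)
    rw [d2]; simp [map_ofNat]

/-- **Remark 2.1: in characteristic `3`, `∇E_t(p) = t·(p₁p₂, p₀p₂, p₀p₁)`.**
[cite: ArtebaniDolgachev2009, §2, Remark 2.1] -/
theorem hesseE_eval_pderiv_of_three_eq_zero (h3 : (3 : K) = 0) (t : K) (p : Fin 3 → K) :
    (fun i => eval p (pderiv i 𝐄[t])) = t • ![p 1 * p 2, p 0 * p 2, p 0 * p 1] := by
  rw [hesseE_eval_pderiv]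
  funext i; fin_cases i <;> simp [h3]

/-- **Remark 2.1: in characteristic `3` the pencil is `xyz + t(x + y + z)³`** —
`E_t = (X + Y + Z)³ + t·XYZ` in `K[X, Y, Z]` when `3 = 0`. [cite: ArtebaniDolgachev2009, §2, Remark 2.1] -/
theorem hesseE_of_three_eq_zero (h3 : (3 : K) = 0) (t : K) :
    (𝐄[t] : MvPolynomial (Fin 3) K) = (X 0 + X 1 + X 2) ^ 3 + C t * (X 0 * X 1 * X 2) := by
  have h3' : (3 : MvPolynomial (Fin 3) K) = 0 := by
    rw [← map_ofNat C 3, show (OfNat.ofNat 3 : K) = 0 from h3, C_0]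
  linear_combination (-(X 0 ^ 2 * X 1 + X 0 ^ 2 * X 2 + X 1 ^ 2 * X 0 + X 1 ^ 2 * X 2 + X 2 ^ 2 * X 0 +
    X 2 ^ 2 * X 1 + 2 * (X 0 * X 1 * X 2))) * h3'

/-- **Remark 2.1: the singular member `(x + y + z)³ = 0`** — `E_0 = (X + Y + Z)³` when `3 = 0` (the
other singular member, `xyz = 0`, is `E_∞`). [cite: ArtebaniDolgachev2009, §2, Remark 2.1] -/
theorem hesseE_zero_of_three_eq_zero (h3 : (3 : K) = 0) :
    (𝐄[(0 : K)] : MvPolynomial (Fin 3) K) = (X 0 + X 1 + X 2) ^ 3 := by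
  rw [hesseE_of_three_eq_zero h3, C_0, zero_mul, add_zero]

/-- **Remark 2.1: the nonsingular members in characteristic `3` are exactly `E_t`, `t ≠ 0`** —
for `3 = 0`, `E_t` has a singular point (a non-zero `p` with `E_t(p) = 0` and `∇E_t(p) = 0`) if and
only if `t = 0`: for `t ≠ 0`, `∇E_t = t·(yz, xz, xy) = 0` forces two coordinates to vanish and then
`E_t(p) = p_i³ = 0`; for `t = 0` every point of the line `x + y + z = 0`, e.g. `(1, −1, 0)`, is
singular. [cite: ArtebaniDolgachev2009, §2, Remark 2.1 ("two singular members")] -/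
theorem hesseE_singular_iff_of_three_eq_zero (h3 : (3 : K) = 0) (t : K) :
    (∃ p : Fin 3 → K, p ≠ 0 ∧ eval p 𝐄[t] = 0 ∧ (fun i => eval p (pderiv i 𝐄[t])) = 0) ↔ t = 0 := by
  constructor
  · rintro ⟨p, hp0, hE, hg⟩
    by_contra ht
    rw [hesseE_eval_pderiv_of_three_eq_zero h3, smul_eq_zero, or_iff_right ht] at hg
    have g0 : p 1 * p 2 = 0 := by simpa using congrFun hg 0
    have g1 : p 0 * p 2 = 0 := by simpa using congrFun hg 1
    have g2 : p 0 * p 1 = 0 := by simpa using congrFun hg 2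
    rw [hesseE_eval, mul_assoc, g0, mul_zero, mul_zero, add_zero] at hE
    apply hp0
    by_cases h0 : p 0 = 0
    · by_cases h1 : p 1 = 0
      · have h2 : p 2 = 0 := (pow_eq_zero_iff three_ne_zero).1 (by
          rw [h0, h1] at hE; simpa using hE)
        funext i; fin_cases i <;> assumption
      · have h2 : p 2 = 0 := (mul_eq_zero.1 g0).resolve_left h1
        exact absurd ((pow_eq_zero_iff three_ne_zero).1 (by rw [h0, h2] at hE; simpa using hE)) h1
    · have h1 : p 1 = 0 := (mul_eq_zero.1 g2).resolve_left h0
      have h2 : p 2 = 0 := (mul_eq_zero.1 g1).resolve_left h0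
      exact absurd ((pow_eq_zero_iff three_ne_zero).1 (by rw [h1, h2] at hE; simpa using hE)) h0
  · rintro rfl
    refine ⟨![1, -1, 0], ?_, ?_, ?_⟩
    · intro h; simpa using congrFun h 0
    · simp; norm_num
    · rw [hesseE_eval_pderiv_of_three_eq_zero h3, zero_smul]

/-- **Remark 2.1, "each of multiplicity `3`"**: for `3 = 0`, `u³ + v³ = (u + v)³` — on each side of
the triangle `xyz = 0` the cubic `X³ + Y³ + Z³` restricts to a perfect cube, vanishing to order `3`
at the single base point of that side. [cite: ArtebaniDolgachev2009, §2, Remark 2.1] -/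
theorem cube_add_cube_of_three_eq_zero (h3 : (3 : K) = 0) (u v : K) :
    u ^ 3 + v ^ 3 = (u + v) ^ 3 := by
  linear_combination (-(u * v * (u + v))) * h3

/-- **Remark 2.1: "It has three base points `(1, −1, 0), (0, 1, −1), (1, 0, −1)`"** — for `3 = 0`, a
non-zero common zero `p` of `XYZ` and `X³ + Y³ + Z³` (equivalently of all members `E_t`) is
`c·(0, 1, −1)`, `c·(1, 0, −1)` or `c·(1, −1, 0)` with `c ≠ 0`: the nine base points of
`HessePencilTriangles.hesse_basePoint_cases` with `ω = 1` (`ω² + ω + 1 = 3 = 0`).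
[cite: ArtebaniDolgachev2009, §2, Remark 2.1] -/
theorem hesse_basePoint_cases_of_three_eq_zero (h3 : (3 : K) = 0) {p : Fin 3 → K} (hp0 : p ≠ 0)
    (hπ : p 0 * p 1 * p 2 = 0) (hS : p 0 ^ 3 + p 1 ^ 3 + p 2 ^ 3 = 0) :
    ∃ c : K, c ≠ 0 ∧ (p = c • ![0, 1, -1] ∨ p = c • ![1, 0, -1] ∨ p = c • ![1, -1, 0]) := by
  have hω : (1 : K) ^ 2 + 1 + 1 = 0 := by rw [one_pow]; linear_combination h3
  obtain ⟨c, k, hc, -, h⟩ := hesse_basePoint_cases hω hp0 hπ hS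
  rw [one_pow] at h
  exact ⟨c, hc, h⟩

/-- The three points `c·(0, 1, −1)`, `c·(1, 0, −1)`, `c·(1, −1, 0)` lie on `XYZ = 0`, on
`X³ + Y³ + Z³ = 0`, hence on every member `E_t` (any field, any `t`, any `c`).
[cite: ArtebaniDolgachev2009, §2, Remark 2.1 (the three base points)] -/
theorem hesse_three_basePoints (t c : K) :
    ∀ q ∈ [c • ![(0 : K), 1, -1], c • ![1, 0, -1], c • ![1, -1, 0]],
      (q : Fin 3 → K) 0 * q 1 * q 2 = 0 ∧ q 0 ^ 3 + q 1 ^ 3 + q 2 ^ 3 = 0 ∧ eval q 𝐄[t] = 0 := by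
  intro q hq
  simp only [List.mem_cons, List.not_mem_nil, or_false] at hq
  rcases hq with rfl | rfl | rfl
  · simp; ring
  · simp; ring
  · simp; ring

/-- **Remark 2.1: "which are the inflection points of all nonsingular members of the pencil"** — for
`3 = 0`, `t ≠ 0` and `c ≠ 0`, each of the three base points `q` is a point of `E_t` with
`∇E_t(q) ≠ 0`, and for every direction `v` in the tangent at `q` (`⟨∇E_t(q), v⟩ = 0`) the restriction
`E_t(q + Tv)` is divisible by `T³`: at `q = c(1, −1, 0)` the tangent is `z = 0` and
`E_t(q + Tv) = (c + Tv₀)³ + (−c + Tv₁)³ = T³(v₀ + v₁)³`; similarly at the other two.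
[cite: ArtebaniDolgachev2009, §2, Remark 2.1] -/
theorem hesse_three_basePoints_flex_of_three_eq_zero (h3 : (3 : K) = 0) {t : K} (ht : t ≠ 0)
    {c : K} (hc : c ≠ 0) :
    ∀ q ∈ [c • ![(0 : K), 1, -1], c • ![1, 0, -1], c • ![1, -1, 0]],
      (q : Fin 3 → K) ≠ 0 ∧ eval q 𝐄[t] = 0 ∧ (fun i => eval q (pderiv i 𝐄[t])) ≠ 0 ∧
        ∀ v : Fin 3 → K, (fun i => eval q (pderiv i 𝐄[t])) ⬝ᵥ v = 0 →
          Polynomial.X ^ 3 ∣ linePoly 𝐄[t] q v := by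
  have h3X : (3 : Polynomial K) = 0 := by
    rw [← map_ofNat Polynomial.C 3, show (OfNat.ofNat 3 : K) = 0 from h3, map_zero]
  have htc : t * (c * c) ≠ 0 := mul_ne_zero ht (mul_ne_zero hc hc)
  intro q hq
  obtain ⟨-, -, hqE⟩ := hesse_three_basePoints t c q hq
  refine ⟨?_, hqE, ?_, ?_⟩
  · simp only [List.mem_cons, List.not_mem_nil, or_false] at hq
    rcases hq with rfl | rfl | rfl
    · intro e; simpa [hc] using congrFun e 1
    · intro e; simpa [hc] using congrFun e 0
    · intro e; simpa [hc] using congrFun e 0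
  · rw [hesseE_eval_pderiv_of_three_eq_zero h3]
    simp only [List.mem_cons, List.not_mem_nil, or_false] at hq
    rcases hq with rfl | rfl | rfl
    · intro e; have := congrFun e 0; simp [ht, hc] at this
    · intro e; have := congrFun e 1; simp [ht, hc] at this
    · intro e; have := congrFun e 2; simp [ht, hc] at this
  · intro v hv
    rw [hesseE_eval_pderiv_of_three_eq_zero h3] at hv
    simp only [List.mem_cons, List.not_mem_nil, or_false] at hq
    rcases hq with rfl | rfl | rfl
    · -- `q = c(0, 1, −1)`: the tangent is `x = 0`, `v₀ = 0`
      have hv0 : v 0 = 0 := by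
        simp [dotProduct, Fin.sum_univ_three, ht, hc] at hv
        exact hv
      refine ⟨Polynomial.C (v 1 ^ 3 + v 2 ^ 3), ?_⟩
      simp only [linePoly, map_add, map_mul, map_pow, MvPolynomial.aeval_X,
        Pi.smul_apply, smul_eq_mul, hv0]
      simp
      linear_combination (Polynomial.C c * Polynomial.X ^ 2 * (Polynomial.C (v 1) ^ 2 - Polynomial.C (v 2) ^ 2) +
        Polynomial.C c ^ 2 * Polynomial.X * (Polynomial.C (v 1) + Polynomial.C (v 2))) * h3X
    · -- `q = c(1, 0, −1)`: the tangent is `y = 0`, `v₁ = 0`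
      have hv1 : v 1 = 0 := by
        simp [dotProduct, Fin.sum_univ_three, ht, hc] at hv
        exact hv
      refine ⟨Polynomial.C (v 0 ^ 3 + v 2 ^ 3), ?_⟩
      simp only [linePoly, map_add, map_mul, map_pow, MvPolynomial.aeval_X,
        Pi.smul_apply, smul_eq_mul, hv1]
      simp
      linear_combination (Polynomial.C c * Polynomial.X ^ 2 * (Polynomial.C (v 0) ^ 2 - Polynomial.C (v 2) ^ 2) +
        Polynomial.C c ^ 2 * Polynomial.X * (Polynomial.C (v 0) + Polynomial.C (v 2))) * h3X
    · -- `q = c(1, −1, 0)`: the tangent is `z = 0`, `v₂ = 0`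
      have hv2 : v 2 = 0 := by
        simp [dotProduct, Fin.sum_univ_three, ht, hc] at hv
        exact hv
      refine ⟨Polynomial.C (v 0 ^ 3 + v 1 ^ 3), ?_⟩
      simp only [linePoly, map_add, map_mul, map_pow, MvPolynomial.aeval_X,
        Pi.smul_apply, smul_eq_mul, hv2]
      simp
      linear_combination (Polynomial.C c * Polynomial.X ^ 2 * (Polynomial.C (v 0) ^ 2 - Polynomial.C (v 1) ^ 2) +
        Polynomial.C c ^ 2 * Polynomial.X * (Polynomial.C (v 0) + Polynomial.C (v 1))) * h3X


/-! ### §1b Remark 2.1: "two singular members: `(x + y + z)³ = 0` and `xyz = 0`" -/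

/-- The partial derivatives of the member `s(X³ + Y³ + Z³) + t·XYZ` (any field). [folklore] -/
private theorem pderiv_member (s t : K) :
    (pderiv 0 (C s * (X 0 ^ 3 + X 1 ^ 3 + X 2 ^ 3) + C t * (X 0 * X 1 * X 2) : MvPolynomial (Fin 3) K) =
        3 * C s * X 0 ^ 2 + C t * (X 1 * X 2)) ∧
      (pderiv 1 (C s * (X 0 ^ 3 + X 1 ^ 3 + X 2 ^ 3) + C t * (X 0 * X 1 * X 2) : MvPolynomial (Fin 3) K) =
        3 * C s * X 1 ^ 2 + C t * (X 0 * X 2)) ∧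
      (pderiv 2 (C s * (X 0 ^ 3 + X 1 ^ 3 + X 2 ^ 3) + C t * (X 0 * X 1 * X 2) : MvPolynomial (Fin 3) K) =
        3 * C s * X 2 ^ 2 + C t * (X 0 * X 1)) := by
  refine ⟨?_, ?_, ?_⟩
  · simp only [map_add, Derivation.leibniz, Derivation.leibniz_pow, pderiv_C, pderiv_X]
    simp
    ring
  · simp only [map_add, Derivation.leibniz, Derivation.leibniz_pow, pderiv_C, pderiv_X]
    simp
    ring
  · simp only [map_add, Derivation.leibniz, Derivation.leibniz_pow, pderiv_C, pderiv_X]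
    simp
    ring

/-- **The whole pencil `s(x³ + y³ + z³) + t·xyz` in characteristic `3`: value and gradient** —
`M_{s,t}(p) = s(p₀³ + p₁³ + p₂³) + t·p₀p₁p₂` and, for `3 = 0`, `∇M_{s,t}(p) = t·(p₁p₂, p₀p₂, p₀p₁)`
(independent of `s`). [cite: ArtebaniDolgachev2009, §2, Remark 2.1 (the pencil (2) in
characteristic 3)] -/
theorem hesse_member_eval_grad_of_three_eq_zero (h3 : (3 : K) = 0) (s t : K) (p : Fin 3 → K) :
    eval p (C s * (X 0 ^ 3 + X 1 ^ 3 + X 2 ^ 3) + C t * (X 0 * X 1 * X 2) : MvPolynomial (Fin 3) K) =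
        s * (p 0 ^ 3 + p 1 ^ 3 + p 2 ^ 3) + t * (p 0 * p 1 * p 2) ∧
      (fun i => eval p (pderiv i
        (C s * (X 0 ^ 3 + X 1 ^ 3 + X 2 ^ 3) + C t * (X 0 * X 1 * X 2) : MvPolynomial (Fin 3) K))) =
        t • ![p 1 * p 2, p 0 * p 2, p 0 * p 1] := by
  obtain ⟨d0, d1, d2⟩ := pderiv_member s t
  refine ⟨by simp, ?_⟩
  funext i
  fin_cases i
  · show eval p (pderiv 0 _) = _
    rw [d0]; simp [map_ofNat, h3]
  · show eval p (pderiv 1 _) = _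
    rw [d1]; simp [map_ofNat, h3]
  · show eval p (pderiv 2 _) = _
    rw [d2]; simp [map_ofNat, h3]

/-- **Artebani–Dolgachev, Remark 2.1: "The Hesse pencil (2) in characteristic 3 has two singular
members: `(x + y + z)³ = 0` and `xyz = 0`."**  For `3 = 0` and ANY `(s, t)`: the member
`s(x³ + y³ + z³) + t·xyz` has a singular point (`p ≠ 0`, `M(p) = 0`, `∇M(p) = 0`, coordinates in `K`)
iff `st = 0` — i.e. exactly the members `(s : t) = (1 : 0)` (`= (x + y + z)³`, `hesseE_zero_of_three_eq_zero`)
and `(0 : 1)` (`xyz`).  (For `t ≠ 0` a singular point has two vanishing coordinates, so `M(p) = s·c³`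
forces `s = 0`; conversely `(1, 0, 0)` is singular on `t·xyz` and `(1, −1, 0)` on `s(x + y + z)³`.)
[cite: ArtebaniDolgachev2009, §2, Remark 2.1] -/
theorem hesse_pencil_singular_iff_of_three_eq_zero (h3 : (3 : K) = 0) (s t : K) :
    (∃ p : Fin 3 → K, p ≠ 0 ∧
        eval p (C s * (X 0 ^ 3 + X 1 ^ 3 + X 2 ^ 3) + C t * (X 0 * X 1 * X 2) : MvPolynomial (Fin 3) K) = 0 ∧
        (fun i => eval p (pderiv i
          (C s * (X 0 ^ 3 + X 1 ^ 3 + X 2 ^ 3) + C t * (X 0 * X 1 * X 2) : MvPolynomial (Fin 3) K))) = 0) ↔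
      s * t = 0 := by
  constructor
  · rintro ⟨p, hp0, hM, hg⟩
    obtain ⟨e1, e2⟩ := hesse_member_eval_grad_of_three_eq_zero h3 s t p
    rw [e1] at hM
    rw [e2] at hg
    by_cases ht : t = 0
    · rw [ht, mul_zero]
    · rw [smul_eq_zero, or_iff_right ht] at hg
      have g0 : p 1 * p 2 = 0 := by simpa using congrFun hg 0
      have g1 : p 0 * p 2 = 0 := by simpa using congrFun hg 1
      have g2 : p 0 * p 1 = 0 := by simpa using congrFun hg 2
      rw [g2, zero_mul, mul_zero, add_zero] at hM
      -- two coordinates vanish; the third is non-zero, so `s = 0`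
      have hs : s = 0 := by
        by_contra hs
        have hS : p 0 ^ 3 + p 1 ^ 3 + p 2 ^ 3 = 0 := (mul_eq_zero.1 hM).resolve_left hs
        apply hp0
        by_cases h0 : p 0 = 0
        · by_cases h1 : p 1 = 0
          · have h2 : p 2 = 0 := (pow_eq_zero_iff three_ne_zero).1 (by
              rw [h0, h1] at hS; simpa using hS)
            funext i; fin_cases i <;> assumption
          · have h2 : p 2 = 0 := (mul_eq_zero.1 g0).resolve_left h1
            exact absurd ((pow_eq_zero_iff three_ne_zero).1
              (by rw [h0, h2] at hS; simpa using hS)) h1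
        · have h1 : p 1 = 0 := (mul_eq_zero.1 g2).resolve_left h0
          have h2 : p 2 = 0 := (mul_eq_zero.1 g1).resolve_left h0
          exact absurd ((pow_eq_zero_iff three_ne_zero).1
            (by rw [h1, h2] at hS; simpa using hS)) h0
      rw [hs, zero_mul]
  · intro hst
    rcases mul_eq_zero.1 hst with hs | ht
    · -- `t·xyz`: the vertex `(1, 0, 0)`
      refine ⟨![1, 0, 0], fun h => by simpa using congrFun h 0, ?_, ?_⟩
      · rw [(hesse_member_eval_grad_of_three_eq_zero h3 s t _).1, hs]; simp
      · rw [(hesse_member_eval_grad_of_three_eq_zero h3 s t _).2]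
        funext i; fin_cases i <;> simp
    · -- `s(x + y + z)³`: the point `(1, −1, 0)` of the triple line
      refine ⟨![1, -1, 0], fun h => by simpa using congrFun h 0, ?_, ?_⟩
      · rw [(hesse_member_eval_grad_of_three_eq_zero h3 s t _).1, ht]; simp
        right; norm_num
      · rw [(hesse_member_eval_grad_of_three_eq_zero h3 s t _).2, ht]
        funext i; fin_cases i <;> simp

end RemarkTwoOne

section RemarkFiveFive

variable {R : Type u} [CommRing R]

/-! ## §2 Remark 5.5: the `g₁`-invariants `X, Y, Z, W` and the cubic surface `X³ + Y³ + Z²W = XYZ` -/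

/-- **"The polynomials `(X, Y, Z, W) = (x²y + y²z + z²x, xy² + yz² + zx², x³ + y³ + z³, xyz)` are
invariant with respect to `g₁`"** (`g₁(x, y, z) = (y, z, x)`): under the substitution `X₀ ↦ X₁`,
`X₁ ↦ X₂`, `X₂ ↦ X₀` each of the four is carried to itself (any commutative ring, any
characteristic). [cite: ArtebaniDolgachev2009, §5, Remark 5.5; §4 (`g₁(x, y, z) = (y, z, x)`)] -/
theorem rename_g₁_XYZW :
    rename ![(1 : Fin 3), 2, 0] (𝓧 : MvPolynomial (Fin 3) R) = 𝓧 ∧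
    rename ![(1 : Fin 3), 2, 0] (𝓨 : MvPolynomial (Fin 3) R) = 𝓨 ∧
    rename ![(1 : Fin 3), 2, 0] (𝓩 : MvPolynomial (Fin 3) R) = 𝓩 ∧
    rename ![(1 : Fin 3), 2, 0] (𝓦 : MvPolynomial (Fin 3) R) = 𝓦 := by
  refine ⟨?_, ?_, ?_, ?_⟩ <;> (simp [rename_X]; ring)

/-- **The integral identity behind Remark 5.5**: in `R[X, Y, Z]` over ANY commutative ring,
`𝓧³ + 𝓨³ + 𝓩²𝓦 − 𝓧𝓨𝓩 = 3·𝓦·(𝓩𝓦 + 2(X³Y³ + Y³Z³ + Z³X³) + 3𝓦²)`.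
[cite: ArtebaniDolgachev2009, §5, Remark 5.5 (equation (cubic), after [Ran] (3.1))] -/
theorem cubicSurface_identity :
    (𝓧 : MvPolynomial (Fin 3) R) ^ 3 + 𝓨 ^ 3 + 𝓩 ^ 2 * 𝓦 - 𝓧 * 𝓨 * 𝓩 =
      C 3 * (𝓦 * (𝓩 * 𝓦 + C 2 * (X 0 ^ 3 * X 1 ^ 3 + X 1 ^ 3 * X 2 ^ 3 + X 2 ^ 3 * X 0 ^ 3) +
        C 3 * 𝓦 ^ 2)) := by
  simp only [map_ofNat]
  ring

/-- **Remark 5.5: "map `ℙ²` onto a cubic surface in `ℙ³` given by the equation `X³ + Y³ + Z²W = XYZ`"**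
— in characteristic `3` (`3 = 0` in `R`) the four polynomials satisfy `𝓧³ + 𝓨³ + 𝓩²𝓦 = 𝓧𝓨𝓩`
identically in `R[X, Y, Z]` (the "into" half of "onto"). [cite: ArtebaniDolgachev2009, §5, Remark 5.5] -/
theorem cubicSurface_of_three_eq_zero (h3 : (3 : R) = 0) :
    (𝓧 : MvPolynomial (Fin 3) R) ^ 3 + 𝓨 ^ 3 + 𝓩 ^ 2 * 𝓦 = 𝓧 * 𝓨 * 𝓩 := by
  rw [← sub_eq_zero, cubicSurface_identity, h3, C_0, zero_mul]

/-- The same, as the pull-back of the surface `𝐒 = U₀³ + U₁³ + U₂²U₃ − U₀U₁U₂ ∈ R[U₀, …, U₃]` along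
`(U₀, U₁, U₂, U₃) ↦ (𝓧, 𝓨, 𝓩, 𝓦)`: over any ring `𝐒(𝓧, 𝓨, 𝓩, 𝓦) = 3·𝓦·(…)`.
[cite: ArtebaniDolgachev2009, §5, Remark 5.5] -/
theorem bind₁_cubicSurface :
    bind₁ (![𝓧, 𝓨, 𝓩, 𝓦] : Fin 4 → MvPolynomial (Fin 3) R) 𝐒 =
      C 3 * (𝓦 * (𝓩 * 𝓦 + C 2 * (X 0 ^ 3 * X 1 ^ 3 + X 1 ^ 3 * X 2 ^ 3 + X 2 ^ 3 * X 0 ^ 3) +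
        C 3 * 𝓦 ^ 2)) := by
  rw [← cubicSurface_identity]
  simp [bind₁_X_right]

/-- **Remark 5.5, characteristic `3`: `ℙ² → {X³ + Y³ + Z²W = XYZ}`** — for `3 = 0` the pull-back of
the surface equation vanishes identically: `𝐒(𝓧, 𝓨, 𝓩, 𝓦) = 0` in `R[X, Y, Z]`.
[cite: ArtebaniDolgachev2009, §5, Remark 5.5] -/
theorem bind₁_cubicSurface_of_three_eq_zero (h3 : (3 : R) = 0) :
    bind₁ (![𝓧, 𝓨, 𝓩, 𝓦] : Fin 4 → MvPolynomial (Fin 3) R) 𝐒 = 0 := by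
  rw [bind₁_cubicSurface, h3, C_0, zero_mul]

/-- **"Among the singular points of the cubic surface, `(0, 0, 0, 1)`"** — the point `(0, 0, 0, 1)`
lies on `𝐒 = U₀³ + U₁³ + U₂²U₃ − U₀U₁U₂` and all four partial derivatives
`(3U₀² − U₁U₂, 3U₁² − U₀U₂, 2U₂U₃ − U₀U₁, U₂²)` vanish there (over any commutative ring; the type
`E₆⁽¹⁾` of the double point is not formalised). [cite: ArtebaniDolgachev2009, §5, Remark 5.5] -/
theorem cubicSurface_singular_vertex :
    eval (![0, 0, 0, 1] : Fin 4 → R) 𝐒 = 0 ∧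
      ∀ i : Fin 4, eval (![0, 0, 0, 1] : Fin 4 → R) (pderiv i 𝐒) = 0 := by
  refine ⟨by simp, fun i => ?_⟩
  fin_cases i <;> simp [pderiv_X]

/-- **"The image of the member `E_λ` of the Hesse pencil is the plane section `Z + λW = 0`"**:
`E_t = 𝓩 + t·𝓦`, i.e. `E_t` is the pull-back of the plane `U₂ + tU₃` (any ring).
[cite: ArtebaniDolgachev2009, §5, Remark 5.5] -/
theorem hesseE_eq_section (t : R) :
    (𝐄[t] : MvPolynomial (Fin 3) R) = 𝓩 + C t * 𝓦 ∧
      bind₁ (![𝓧, 𝓨, 𝓩, 𝓦] : Fin 4 → MvPolynomial (Fin 3) R) (X 2 + C t * X 3) = 𝐄[t] := by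
  refine ⟨rfl, ?_⟩
  simp [bind₁_X_right]

/-- **"λ = λ′³", integral form**: over any commutative ring and for every `s`,
`E_s(s𝓧, s𝓨, −𝓩) = −𝓩²·E_{s³} + 3s³·𝓦·(𝓩𝓦 + 2(X³Y³ + Y³Z³ + Z³X³) + 3𝓦²)` in `R[X, Y, Z]`
(`E_s(s𝓧, s𝓨, −𝓩) = s³(𝓧³ + 𝓨³ − 𝓧𝓨𝓩) − 𝓩³` and `−𝓩²E_{s³} = −𝓩³ − s³𝓩²𝓦` differ by `s³` times
the identity `cubicSurface_identity`). [cite: ArtebaniDolgachev2009, §5, Remark 5.5] -/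
theorem bind₁_hesseE_projection (s : R) :
    bind₁ (![C s * 𝓧, C s * 𝓨, -𝓩] : Fin 3 → MvPolynomial (Fin 3) R) 𝐄[s] =
      -(𝓩 ^ 2) * 𝐄[s ^ 3] + C (3 * s ^ 3) * (𝓦 * (𝓩 * 𝓦 +
        C 2 * (X 0 ^ 3 * X 1 ^ 3 + X 1 ^ 3 * X 2 ^ 3 + X 2 ^ 3 * X 0 ^ 3) + C 3 * 𝓦 ^ 2)) := by
  simp only [map_add, map_mul, map_pow, bind₁_X_right, bind₁_C_right, map_ofNat]
  simp
  ring

/-- **Remark 5.5: "the image of this pencil of plane sections under the projection from the singular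
point is the Hesse pencil. The parameter `λ` of the original pencil and the new parameter `λ′` are
related by `λ = λ′³`"** — for `3 = 0` and every `s`: `E_s(s𝓧, s𝓨, −𝓩) = −𝓩² · E_{s³}` in
`K[X, Y, Z]`.  Reading: a point `p` of `E_λ`, `λ = s³`, goes to `(𝓧 : 𝓨 : 𝓩 : 𝓦)(p)` on the section
`Z + λW = 0` of the surface, whose projection from `(0, 0, 0, 1)` is `(𝓧 : 𝓨 : 𝓩)(p)`; this point
satisfies `E_s ∘ diag(s, s, −1) = 0`, a cubic projectively equivalent to the member `E_{λ′}`,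
`λ′ = s`. [cite: ArtebaniDolgachev2009, §5, Remark 5.5] -/
theorem bind₁_hesseE_projection_of_three_eq_zero (h3 : (3 : R) = 0) (s : R) :
    bind₁ (![C s * 𝓧, C s * 𝓨, -𝓩] : Fin 3 → MvPolynomial (Fin 3) R) 𝐄[s] = -(𝓩 ^ 2) * 𝐄[s ^ 3] := by
  rw [bind₁_hesseE_projection, h3, zero_mul, C_0, zero_mul, add_zero]

/-- **"λ = λ′³", pointwise**: for `3 = 0`, if `p` lies on `E_{s³}` then
`(s·𝓧(p), s·𝓨(p), −𝓩(p))` lies on `E_s`. [cite: ArtebaniDolgachev2009, §5, Remark 5.5] -/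
theorem eval_hesseE_projection_of_three_eq_zero (h3 : (3 : R) = 0) (s : R) {p : Fin 3 → R}
    (hp : eval p 𝐄[s ^ 3] = 0) :
    eval ![s * eval p 𝓧, s * eval p 𝓨, -eval p 𝓩] 𝐄[s] = 0 := by
  have key : ∀ (g : Fin 3 → MvPolynomial (Fin 3) R) (φ : MvPolynomial (Fin 3) R),
      eval p (bind₁ g φ) = eval (fun i => eval p (g i)) φ := fun g φ => eval₂Hom_bind₁ _ _ _ _
  have hfun : (fun i => eval p ((![C s * 𝓧, C s * 𝓨, -𝓩] : Fin 3 → MvPolynomial (Fin 3) R) i)) =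
      ![s * eval p 𝓧, s * eval p 𝓨, -eval p 𝓩] := by
    funext i; fin_cases i <;> simp
  have h := congrArg (eval p) (bind₁_hesseE_projection_of_three_eq_zero h3 s)
  rw [key, map_mul, hp, mul_zero, hfun] at h
  exact h

end RemarkFiveFive

end Literature.AlgebraicGeometry.PlaneCurves
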